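import Literature.Analysis.FluidPDE.VanishingDiffusivitySelectionBVProofs
import Literature.Analysis.FluidPDE.PassiveScalarBoundedContinuity
import Literature.Analysis.FluidPDE.PassiveScalarBoundedExistence
import Literature.Analysis.FluidPDE.PassiveScalarDiagExistence
import HarnessLib

/-!
# Mescolini–Pitcho–Sorella 2025, Theorem 2.4 — DISCHARGED

Analysis/FluidPDE proof file (everything proved; no definitions, no new facts). The named fact
`MescoliniPitchoSorella2025_thm24` of `VanishingDiffusivitySelectionBV.lean` — G. Mescolini,
J. Pitcho, M. Sorella, *On vanishing diffusivity selection for the advection equation*, Ann. Mat.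
Pura Appl. (4) 204 (2025) 1667–1687, **Theorem 2.4** (p. 1671): for `T > 0`, `ν > 0`, a
divergence-free drift `b ∈ L²((0,T) × T^d; ℝ^d)` and `ρ_in ∈ L^∞(T^d)` there EXISTS a weak solution
`ρ^ν ∈ L^∞((0,T) × T^d) ∩ L²((0,T); H¹(T^d))` of `∂ₜρ + b·∇ρ = νΔρ`, `ρ(0) = ρ_in`, with
`‖ρ^ν‖_{L^∞} ≤ ‖ρ_in‖_{L^∞}`, which is the `C([0,T]; L²)` representative and satisfies the energy
inequality (2.3) at every `t ∈ [0,T]`, and it is UNIQUE in that class — is proved here: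
`MescoliniPitchoSorella2025_thm24_holds`.

Assembly of the series `PassiveScalarBounded{Slice, Remainder, EnergyEquality, Continuity, Existence}`
and `PassiveScalarLimitL2tx`:
* existence of a bounded `L²_t H¹_x` weak solution with the maximum principle
  (`Torus.exists_isWeakScalarTransportOn_of_abs_le`: regularisation, classical solutions, weak-*
  compactness, identification for `L²_{t,x}` drifts, weak lower semicontinuity of the dissipation);
* its `C([0,T]; L²)` representative with the energy EQUALITY at every time
  (`Torus.IsWeakScalarTransportOn.exists_l2Continuous_representative_of_abs_le`; the typed (2.3) is
  the printed inequality, implied by the equality);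
* uniqueness in the class (`Torus.IsWeakScalarTransportOn.ae_eq_of_abs_le`), transported from
  "a.e. `t`, a.e. `x`" to the slab measure;
* the degenerate dimension `d = ∅` (the torus is a point; the constant-in-time field is the
  solution, `Torus.isWeakScalarTransportDiagOn_const_of_isEmpty`).

Consequence: `MescoliniPitchoSorella2025_thm14.not_hasAnomalousScalarDissipation` no longer needs
the hypothesis `h24` (`…not_hasAnomalousScalarDissipation'`).

## References

* G. Mescolini, J. Pitcho, M. Sorella, Ann. Mat. Pura Appl. (4) 204 (2025) 1667–1687, Thm. 2.4
  p. 1671, proof pp. 1671–1674. [`MescoliniPitchoSorella2025`]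
* P. Bonicatto, G. Ciampa, G. Crippa, J. Evol. Equ. 24 (2024), Paper No. 1, Thm. 3.3, Remark 3.4
  (energy equality in the parabolic class). [`BonicattoCiampaCrippa2023`]
-/

open MeasureTheory Set Filter Topology Function
open scoped ENNReal NNReal

namespace Literature.Analysis.FluidPDE

noncomputable section

open Literature.Analysis.FunctionSpaces MescoliniPitchoSorella2025

namespace MescoliniPitchoSorella2025

variable {d : Type} [Fintype d]
variable {T ν : ℝ} {b : ℝ → UnitAddTorus d → EuclideanSpace ℝ d} {ρin : UnitAddTorus d → ℝ}

/-! ### Bookkeeping between the slab measure and the iterated measures -/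

/-- An `L²` field on the slab has `∫₀ᵀ ∫ ‖b‖² < ∞` (iterated form). [folklore] -/
private theorem lintegral_lintegral_sq_lt_top_of_memLp (hb : MemLp (uncurry b) 2 (Torus.slabMeasure d T)) :
    ∫⁻ t in Ioo 0 T, ∫⁻ x, ‖b t x‖ₑ ^ 2 < ⊤ := by
  have h1 : ∫⁻ p, ‖uncurry b p‖ₑ ^ 2 ∂(Torus.slabMeasure d T) < ⊤ := by
    rw [← FunctionSpaces.eLpNorm_two_pow_two_eq_lintegral]
    exact ENNReal.pow_lt_top hb.eLpNorm_lt_top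
  rw [Torus.slabMeasure, lintegral_prod _ (hb.1.aemeasurable.enorm.pow_const 2)] at h1
  exact h1

/-- From an `L^∞` bound on the slab to the iterated a.e. bound `|ρ(t,x)| ≤ ‖ρ‖_{L^∞}`. [folklore] -/
private theorem ae_ae_abs_le_of_memLp_top {ρ : ℝ → UnitAddTorus d → ℝ}
    (hρ : MemLp (uncurry ρ) ∞ (Torus.slabMeasure d T)) :
    ∀ᵐ t ∂(volume.restrict (Ioo 0 T)), ∀ᵐ x ∂(volume : Measure (UnitAddTorus d)),
      |ρ t x| ≤ (eLpNorm (uncurry ρ) ∞ (Torus.slabMeasure d T)).toReal := by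
  have hne : eLpNorm (uncurry ρ) ∞ (Torus.slabMeasure d T) ≠ ⊤ := hρ.eLpNorm_ne_top
  have hprod : ∀ᵐ p ∂(Torus.slabMeasure d T), |uncurry ρ p| ≤ (eLpNorm (uncurry ρ) ∞ (Torus.slabMeasure d T)).toReal := by
    filter_upwards [ae_le_eLpNormEssSup (f := uncurry ρ) (μ := Torus.slabMeasure d T)] with p hp
    rw [← eLpNorm_exponent_top] at hp
    rw [← Real.norm_eq_abs, ← ENNReal.ofReal_le_iff_le_toReal hne, ofReal_norm]
    exact hp
  rw [Torus.slabMeasure] at hprod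
  exact Measure.ae_ae_of_ae_prod hprod

omit [Fintype d] in
/-- The a.e. bound `|ρ_in| ≤ ‖ρ_in‖_{L^∞}` for an `L^∞` datum. [folklore] -/
private theorem ae_abs_le_of_memLp_top [Fintype d] (hρin : MemLp ρin ∞ volume) :
    ∀ᵐ x ∂(volume : Measure (UnitAddTorus d)), |ρin x| ≤ (eLpNorm ρin ∞ volume).toReal := by
  filter_upwards [ae_le_eLpNormEssSup (f := ρin) (μ := (volume : Measure (UnitAddTorus d)))] with x hx
  rw [← eLpNorm_exponent_top] at hx
  rw [← Real.norm_eq_abs, ← ENNReal.ofReal_le_iff_le_toReal hρin.eLpNorm_ne_top, ofReal_norm]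
  exact hx

/-- From the iterated a.e. bound `|w(t,x)| ≤ H` of a jointly measurable field to `w ∈ L^∞` on the slab
with `‖w‖_{L^∞} ≤ H`. [folklore] -/
private theorem memLp_top_of_ae_ae_abs_le {w : ℝ → UnitAddTorus d → ℝ}
    (hwm : AEStronglyMeasurable (uncurry w) (Torus.slabMeasure d T)) {H : ℝ}
    (hwb : ∀ᵐ t ∂(volume.restrict (Ioo 0 T)), ∀ᵐ x ∂(volume : Measure (UnitAddTorus d)), |w t x| ≤ H) :
    MemLp (uncurry w) ∞ (Torus.slabMeasure d T) ∧
      eLpNorm (uncurry w) ∞ (Torus.slabMeasure d T) ≤ ENNReal.ofReal H := by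
  have hwm' := hwm
  obtain ⟨w', hw'm, hww'⟩ := hwm'
  have hset : MeasurableSet {p : ℝ × UnitAddTorus d | ‖w' p‖ ≤ H} :=
    measurableSet_le hw'm.norm.measurable measurable_const
  -- the bound for the representative, iterated then on the product
  have hww'i : ∀ᵐ t ∂(volume.restrict (Ioo 0 T)), ∀ᵐ x ∂(volume : Measure (UnitAddTorus d)),
      uncurry w (t, x) = w' (t, x) := by
    have h := hww'
    rw [Torus.slabMeasure] at h
    exact Measure.ae_ae_of_ae_prod h
  have hw'b : ∀ᵐ p ∂(Torus.slabMeasure d T), ‖w' p‖ ≤ H := by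
    rw [Torus.slabMeasure, Measure.ae_prod_iff_ae_ae hset]
    filter_upwards [hwb, hww'i] with t ht ht'
    filter_upwards [ht, ht'] with x hx hx'
    rw [← hx', uncurry_apply_pair, Real.norm_eq_abs]
    exact hx
  have hwb' : ∀ᵐ p ∂(Torus.slabMeasure d T), ‖uncurry w p‖ ≤ H := by
    filter_upwards [hw'b, hww'] with p hp hp'
    rw [hp']; exact hp
  refine ⟨memLp_top_of_bound hwm H hwb', ?_⟩
  rw [eLpNorm_exponent_top]
  exact eLpNormEssSup_le_of_ae_bound hwb'

/-- From "equal at a.e. time, a.e. in space" to equality a.e. on the slab, for jointly measurable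
fields. [folklore] -/
private theorem ae_eq_slab_of_ae_ae {ρ₁ ρ₂ : ℝ → UnitAddTorus d → ℝ}
    (h₁ : AEStronglyMeasurable (uncurry ρ₁) (Torus.slabMeasure d T))
    (h₂ : AEStronglyMeasurable (uncurry ρ₂) (Torus.slabMeasure d T))
    (hae : ∀ᵐ t ∂(volume.restrict (Ioo 0 T)), ρ₁ t =ᵐ[volume] ρ₂ t) :
    uncurry ρ₁ =ᵐ[Torus.slabMeasure d T] uncurry ρ₂ := by
  obtain ⟨f, hfm, hff⟩ := (h₁.sub h₂ : AEStronglyMeasurable (uncurry ρ₁ - uncurry ρ₂) (Torus.slabMeasure d T))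
  have hset : MeasurableSet {p : ℝ × UnitAddTorus d | f p = 0} :=
    hfm.measurableSet_eq_fun stronglyMeasurable_const
  have hffi : ∀ᵐ t ∂(volume.restrict (Ioo 0 T)), ∀ᵐ x ∂(volume : Measure (UnitAddTorus d)),
      (uncurry ρ₁ - uncurry ρ₂) (t, x) = f (t, x) := by
    have h := hff
    rw [Torus.slabMeasure] at h
    exact Measure.ae_ae_of_ae_prod h
  have hf0 : ∀ᵐ p ∂(Torus.slabMeasure d T), f p = 0 := by
    rw [Torus.slabMeasure, Measure.ae_prod_iff_ae_ae hset]
    filter_upwards [hae, hffi] with t ht ht'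
    filter_upwards [ht, ht'] with x hx hx'
    rw [← hx', Pi.sub_apply, uncurry_apply_pair, uncurry_apply_pair, hx, sub_self]
  filter_upwards [hf0, hff] with p hp hp'
  have e : (uncurry ρ₁ - uncurry ρ₂) p = 0 := by rw [hp', hp]
  rwa [Pi.sub_apply, sub_eq_zero] at e

/-! ### The degenerate dimension `d = ∅` -/

/-- For `d = ∅` the spectral gradient norm vanishes (the only frequency is `k = 0`, of weight `0`).
[folklore] -/
private theorem eScalarGradNormSq_of_isEmpty [IsEmpty d] (θ : UnitAddTorus d → ℝ) :
    Torus.eScalarGradNormSq θ = 0 := by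
  rw [Torus.eScalarGradNormSq_eq_tsum]
  simp [FunctionSpaces.Torus.freqNormSq, Finset.univ_eq_empty]

/-! ### Theorem 2.4 -/

/-- **Mescolini–Pitcho–Sorella 2025, Theorem 2.4, PROVED** (discharge of the named fact
`MescoliniPitchoSorella2025_thm24`): for `T > 0`, `ν > 0`, a divergence-free drift
`b ∈ L²((0,T) × T^d; ℝ^d)` and `ρ_in ∈ L^∞(T^d)`, there is a weak solution of
`∂ₜρ + b·∇ρ = νΔρ`, `ρ(0) = ρ_in` in the class `L^∞((0,T) × T^d) ∩ L²((0,T); H¹(T^d))`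
(`IsBoundedEnergySolution`) with `‖ρ‖_{L^∞((0,T)×T^d)} ≤ ‖ρ_in‖_{L^∞}`, which is the `C([0,T]; L²)`
representative and satisfies `‖ρ(t)‖² + 2ν∫₀ᵗ‖∇ρ‖² ≤ ‖ρ_in‖²` for every `t ∈ [0,T]` (in fact with
equality); and any two solutions of the class agree a.e. on the slab. Proof: the files
`PassiveScalarBounded{Slice,Remainder,EnergyEquality,Continuity,Existence}`, `PassiveScalarLimitL2tx`
(mollified energy balance with the remainder controlled by `‖(ρ - ρ ⋆ k ⋆ k)·‖b‖‖_{L²} → 0`,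
DiPerna–Lions regularisation scheme with the maximum principle, weak lower semicontinuity,
Radon–Riesz). [cite: MescoliniPitchoSorella2025, Thm. 2.4 p. 1671, proof pp. 1671–1674] -/
theorem _root_.Literature.Analysis.FluidPDE.MescoliniPitchoSorella2025_thm24_holds :
    MescoliniPitchoSorella2025_thm24 := by
  intro d _ _ T ν b ρin hT hν hb hdiv hρin
  -- conversions
  have hu2 := lintegral_lintegral_sq_lt_top_of_memLp hb
  have hum : AEStronglyMeasurable (Torus.stLift b) (volume.restrict (Ioo 0 T ×ˢ univ)) := by
    have h := hb.1
    rw [Torus.slabMeasure] at h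
    exact Torus.aestronglyMeasurable_stLift_of_uncurry h
  set H : ℝ := (eLpNorm ρin ∞ volume).toReal with hH
  have hHne : eLpNorm ρin ∞ volume ≠ ⊤ := hρin.eLpNorm_ne_top
  have hρb : ∀ᵐ x ∂(volume : Measure (UnitAddTorus d)), |ρin x| ≤ H := ae_abs_le_of_memLp_top hρin
  have hρin2 : MemLp ρin 2 volume := hρin.mono_exponent le_top
  refine ⟨?_, ?_⟩
  · -- EXISTENCE
    rcases isEmpty_or_nonempty d with hd | hd
    · -- `d = ∅`: the torus is a point, the constant field is the solution
      have hvec : ∀ v : EuclideanSpace ℝ d, v = 0 := fun v => Subsingleton.elim v 0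
      have hbtop : MemLp (Torus.stLift b) ∞ (volume.restrict (Ioo 0 T ×ˢ univ)) :=
        memLp_top_of_bound hum 0 (ae_of_all _ fun p => by
          rw [show Torus.stLift b p = 0 from hvec _, norm_zero])
      have hsol : Torus.IsWeakScalarTransportOn T ν b ρin (fun _ => ρin) :=
        Torus.isWeakScalarTransportDiagOn_one_iff.1
          (Torus.isWeakScalarTransportDiagOn_const_of_isEmpty (a := fun _ : d => (1 : ℝ)) hT hρin2 hbtop hdiv)
      have hm : AEStronglyMeasurable (uncurry fun _ : ℝ => ρin) (Torus.slabMeasure d T) := by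
        rw [Torus.slabMeasure]; exact hρin.1.comp_snd
      have hbd : ∀ᵐ t ∂(volume.restrict (Ioo 0 T)), ∀ᵐ x ∂(volume : Measure (UnitAddTorus d)),
          |(fun _ : ℝ => ρin) t x| ≤ H := ae_of_all _ fun _ => hρb
      obtain ⟨hmem, hle⟩ := memLp_top_of_ae_ae_abs_le hm hbd
      have hD0 : ∀ t, Torus.eScalarDissipation ν (fun _ : ℝ => ρin) 0 t = 0 := fun t => by
        rw [Torus.eScalarDissipation]
        simp [eScalarGradNormSq_of_isEmpty]
      refine ⟨fun _ => ρin, ⟨⟨hsol, hmem⟩, ?_⟩, ?_, Torus.isL2ContinuousOn_const_time hρin2 _, fun t _ => ?_⟩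
      · simp [eScalarGradNormSq_of_isEmpty]
      · rwa [hH, ENNReal.ofReal_toReal hHne] at hle
      · rw [hD0 t, mul_zero, add_zero]
    · -- `d ≠ ∅`
      obtain ⟨θ, hθ, -, hθb, hdis⟩ :=
        Torus.exists_isWeakScalarTransportOn_of_abs_le hν hT hρin.1 hρb hum hu2 hdiv
      have hL2fin : ∫⁻ x, ‖ρin x‖ₑ ^ 2 < ⊤ := by
        rw [← FunctionSpaces.eLpNorm_two_pow_two_eq_lintegral]
        exact ENNReal.pow_lt_top hρin2.eLpNorm_lt_top
      have hD : ∫⁻ t in Ioo 0 T, Torus.eScalarGradNormSq (θ t) < ⊤ := by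
        have h1 : 2 * (ENNReal.ofReal ν * ∫⁻ t in Ioo 0 T, Torus.eScalarGradNormSq (θ t)) < ⊤ :=
          hdis.trans_lt hL2fin
        have h2 : ENNReal.ofReal ν * ∫⁻ t in Ioo 0 T, Torus.eScalarGradNormSq (θ t) < ⊤ :=
          lt_of_le_of_lt (le_mul_of_one_le_left bot_le (by norm_num)) h1
        rcases ENNReal.mul_lt_top_iff.1 h2 with h | h | h
        · exact h.2
        · exact absurd h (ENNReal.ofReal_pos.2 hν).ne'
        · rw [h]; exact ENNReal.zero_lt_top
      obtain ⟨w, hw, hwL2, -, -, hwb, hDw, hEw⟩ :=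
        hθ.exists_l2Continuous_representative_of_abs_le hT hρin2 hθb hu2 hD
      have hwm : AEStronglyMeasurable (uncurry w) (Torus.slabMeasure d T) := by
        rw [Torus.slabMeasure]; exact hw.aestronglyMeasurable_uncurry
      obtain ⟨hmem, hle⟩ := memLp_top_of_ae_ae_abs_le hwm hwb
      have hDw' : ∫⁻ t in Ioo 0 T, Torus.eScalarGradNormSq (w t) < ⊤ := by rw [hDw]; exact hD
      refine ⟨w, ⟨⟨hw, hmem⟩, hDw'⟩, ?_, hwL2, fun t ht => ?_⟩
      · rwa [hH, ENNReal.ofReal_toReal hHne] at hle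
      · -- the energy equality at `t`, read as the inequality (2.3)
        have hsub : Ioo 0 t ⊆ Ioo 0 T := Ioo_subset_Ioo_right ht.2
        have hfin : ∫⁻ s in Ioo 0 t, Torus.eScalarGradNormSq (w s) ≠ ⊤ :=
          ((lintegral_mono_set hsub).trans_lt hDw').ne
        have hpos : 0 ≤ ∫ x, w t x ^ 2 := integral_nonneg fun x => sq_nonneg _
        have e := hEw t ht
        refine le_of_eq ?_
        rw [Torus.scalarL2Sq, Torus.scalarL2Sq, Torus.eScalarDissipation, ← e,
          ENNReal.ofReal_add hpos (by positivity), ENNReal.ofReal_mul (by positivity),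
          ENNReal.ofReal_mul zero_le_two, ENNReal.ofReal_ofNat, ENNReal.ofReal_toReal hfin, mul_assoc]
  · -- UNIQUENESS
    intro ρ₁ ρ₂ h₁ h₂
    have hb₁ := ae_ae_abs_le_of_memLp_top h₁.1.2
    have hb₂ := ae_ae_abs_le_of_memLp_top h₂.1.2
    have hae := Torus.IsWeakScalarTransportOn.ae_eq_of_abs_le hν.le h₁.1.1 h₂.1.1 hb₁ hb₂ hu2 h₁.2 h₂.2
    have hm₁ : AEStronglyMeasurable (uncurry ρ₁) (Torus.slabMeasure d T) := by
      rw [Torus.slabMeasure]; exact h₁.1.1.aestronglyMeasurable_uncurry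
    have hm₂ : AEStronglyMeasurable (uncurry ρ₂) (Torus.slabMeasure d T) := by
      rw [Torus.slabMeasure]; exact h₂.1.1.aestronglyMeasurable_uncurry
    exact ae_eq_slab_of_ae_ae hm₁ hm₂ hae

/-- **Fields of class `L¹_loc((0,T]; BV) ∩ L²` are not anomalous scalar dissipators** — the tree's
`MescoliniPitchoSorella2025_thm14.not_hasAnomalousScalarDissipation` with the hypothesis
`MescoliniPitchoSorella2025_thm24` now discharged: under the hypotheses of Thm. 1.4 only Thm. 1.4
itself remains a named fact. [cite: MescoliniPitchoSorella2025, Thm. 1.4 (ii) p. 1669 and Thm. 2.4 p. 1671] -/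
theorem _root_.Literature.Analysis.FluidPDE.MescoliniPitchoSorella2025_thm14.not_hasAnomalousScalarDissipation'
    (h14 : MescoliniPitchoSorella2025_thm14)
    {d : Type} [Fintype d] [DecidableEq d] {T : ℝ} {b : ℝ → UnitAddTorus d → EuclideanSpace ℝ d}
    {ρin : UnitAddTorus d → ℝ} (hT : 0 < T) (hb : MemLp (uncurry b) 2 (Torus.slabMeasure d T))
    (hdiv : ∀ᵐ t ∂(volume.restrict (Ioo 0 T)), Torus.IsWeaklyDivFree (b t))
    (hBV : ∀ a : ℝ, 0 < a → a < T → ∫⁻ t in Icc a T, Literature.Barriers.AnomalousDissipation.torusTotalVariation (b t) < ⊤)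
    (hρin : MemLp ρin ∞ volume) :
    ¬ Torus.HasAnomalousScalarDissipation T b ρin :=
  MescoliniPitchoSorella2025_thm14.not_hasAnomalousScalarDissipation h14 MescoliniPitchoSorella2025_thm24_holds
    hT hb hdiv hBV hρin

end MescoliniPitchoSorella2025

end

end Literature.Analysis.FluidPDE
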